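import Summits.KontsevichZagierPeriods.KontsevichZagierPeriods.Theorems.TerasomaMultiplicationBetaCancellationStubTameFormAux15
import Literature.NumberTheory.Transcendental.KZProductIdeal

/-!
# `BetaCancellation` (stmt-KontsevichZagierPeriods-13633), line `divisor-slicing-transshipment` — stub `stub_tameForm`, auxiliary file 16: gathering and catalytic cylinders

* `MIso.gather` — a finite family of `MIso`s, each from two slots onto one slot, gathers into one
  `MIso` between the juxtaposed families (used to absorb all spectators at once);
* the positive / negative parts of a catalytic product `K × r` (`K = [ℝ, 1/(1+x²)]`, `K.prod r`),
  stabilised, are the **catalytic cylinders** `{w | tail w ∈ stabSet (posSet r)}` with density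
  `(1/(1+w₀²)) · f (tail w)` (index bookkeeping `Fin.castLE` / `Fin.natAdd` only).

References: M. Kontsevich, D. Zagier, *Periods* (2001), §1.2; crux NOTES c6 (F13).
-/

noncomputable section

-- `Summit.KontsevichZagierPeriods.KontsevichZagierPeriods.…` is the tree's mandated layout (single-conjunct summit).
set_option linter.dupNamespace false

namespace Summit.KontsevichZagierPeriods.KontsevichZagierPeriods.BetaCancellationDivisorSlicing

open MeasureTheory Set Function
open Literature.NumberTheory.Transcendental
open Literature.NumberTheory.Transcendental.KZ
open Literature.ModelTheory.ExponentialFields (IsSemialgebraic isSemialgebraic_univ)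

/-! ### Gathering -/

/-- **Gathering a finite family of two-slots-to-one-slot `MIso`s** into one `MIso` between the
juxtaposed slot families. [folklore] -/
theorem MIso.gather {N : ℕ} {ι : Type*} [Fintype ι] {A B C : ι → Set (Fin N → ℝ)}
    {α β γ : ι → (Fin N → ℝ) → ℝ}
    (m : ∀ k, MIso N (Sum.elim (fun _ : Unit => A k) (fun _ : Unit => B k))
      (Sum.elim (fun _ => α k) (fun _ => β k)) (fun _ : Unit => C k) (fun _ => γ k)) :
    Nonempty (MIso N (Sum.elim A B) (Sum.elim α β) C γ) := by
  classical
  refine MIso.of_fintype (P₀ := Σ k, Fin (m k).J)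
    (fun p => Sum.elim (fun _ => Sum.inl p.1) (fun _ => Sum.inr p.1) ((m p.1).src p.2))
    (fun p => p.1) (fun p => (m p.1).P p.2) (fun p => (m p.1).Ψ p.2) (fun p => (m p.1).Ψ' p.2)
    (fun p => ?_) ?_ ?_ ?_ ?_
  · obtain ⟨k, j⟩ := p
    obtain ⟨h1, h2, h3, h4, h5, h6, h7⟩ := (m k).piece j
    refine ⟨h1, ?_, h3, h4, h5, by simpa using h6, fun z hz => ?_⟩
    · rcases hs : (m k).src j with u | u
      · simp only [hs, Sum.elim_inl] at h2 ⊢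
        exact h2
      · simp only [hs, Sum.elim_inr] at h2 ⊢
        exact h2
    · have := h7 z hz
      rcases hs : (m k).src j with u | u
      · simp only [hs, Sum.elim_inl] at this ⊢
        exact this
      · simp only [hs, Sum.elim_inr] at this ⊢
        exact this
  · rintro ⟨k, j⟩ ⟨k', j'⟩ hne h
    have hk : k = k' := by
      rcases hs : (m k).src j with u | u <;> rcases hs' : (m k').src j' with u' | u' <;>
        simp [hs, hs'] at h <;> exact h
    subst hk
    have hjj : j ≠ j' := fun hj => hne (by subst hj; rfl)
    refine (m k).disjoint_src j j' hjj ?_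
    rcases hs : (m k).src j with u | u <;> rcases hs' : (m k).src j' with u' | u' <;>
      simp [hs, hs'] at h ⊢
  · rintro ⟨k, j⟩ ⟨k', j'⟩ hne h
    simp only at h
    subst h
    have hjj : j ≠ j' := fun hj => hne (by subst hj; rfl)
    exact (m k).disjoint_tgt j j' hjj (Subsingleton.elim _ _)
  · rintro (k | k)
    · refine measure_mono_null (fun z hz => ?_) ((m k).cover_src (Sum.inl ()))
      simp only [Set.mem_sdiff, Sum.elim_inl, mem_iUnion, exists_prop, not_exists, not_and] at hz ⊢
      refine ⟨hz.1, fun j hj hzj => hz.2 ⟨k, j⟩ ?_ hzj⟩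
      simp [hj]
    · refine measure_mono_null (fun z hz => ?_) ((m k).cover_src (Sum.inr ()))
      simp only [Set.mem_sdiff, Sum.elim_inr, mem_iUnion, exists_prop, not_exists, not_and] at hz ⊢
      refine ⟨hz.1, fun j hj hzj => hz.2 ⟨k, j⟩ ?_ hzj⟩
      simp [hj]
  · intro k
    refine measure_mono_null (fun z hz => ?_) ((m k).cover_tgt ())
    simp only [Set.mem_sdiff, mem_iUnion, exists_prop, not_exists, not_and] at hz ⊢
    exact ⟨hz.1, fun j _ hzj => hz.2 ⟨k, j⟩ rfl hzj⟩

/-! ### Catalytic cylinders -/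

section Cylinder

variable {n d : ℕ} (K : IntegralRep 1) (hKd : K.domain = Set.univ)
  (hKi : Set.EqOn K.integrand (fun x => 1 / (1 + x 0 ^ 2)) K.domain)

include hKd hKi

/-- The Cauchy density is everywhere `1/(1+x²)`. [folklore] -/
theorem cauchy_integrand (x : Fin 1 → ℝ) : K.integrand x = 1 / (1 + x 0 ^ 2) :=
  hKi (by rw [hKd]; trivial)

/-- The Cauchy density is positive. [folklore] -/
theorem cauchy_pos (x : Fin 1 → ℝ) : 0 < K.integrand x := by
  rw [cauchy_integrand K hKd hKi]; positivity

/-- The integrand of a catalytic product `K × r`. [cite: KontsevichZagier2001, §4.1] -/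
theorem prod_integrand_apply (r : IntegralRep n) (z : Fin (1 + n) → ℝ) :
    (K.prod r).integrand z = 1 / (1 + z (Fin.castAdd n 0) ^ 2) * r.integrand (fun j => z (Fin.natAdd 1 j)) := by
  rw [IntegralRep.prod_integrand_eq, IntegralRep.prodFun_apply, cauchy_integrand K hKd hKi]

/-- The positive part of a catalytic product is the cylinder over the positive part. [folklore] -/
theorem posSet_prod (r : IntegralRep n) :
    posSet (K.prod r) = {z : Fin (1 + n) → ℝ | (fun j => z (Fin.natAdd 1 j)) ∈ posSet r} := by
  ext z
  simp only [mem_posSet, IntegralRep.prod_domain, IntegralRep.mem_prodDomain, hKd, mem_univ, true_and,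
    mem_setOf_eq, prod_integrand_apply K hKd hKi]
  refine and_congr Iff.rfl ⟨fun h => ?_, fun h => mul_pos (by positivity) h⟩
  by_contra h'
  push Not at h'
  exact absurd h (not_lt.mpr (mul_nonpos_of_nonneg_of_nonpos (by positivity) h'))

/-- The negative part of a catalytic product is the cylinder over the negative part. [folklore] -/
theorem negSet_prod (r : IntegralRep n) :
    negSet (K.prod r) = {z : Fin (1 + n) → ℝ | (fun j => z (Fin.natAdd 1 j)) ∈ negSet r} := by
  ext z
  simp only [mem_negSet, IntegralRep.prod_domain, IntegralRep.mem_prodDomain, hKd, mem_univ, true_and,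
    mem_setOf_eq, prod_integrand_apply K hKd hKi]
  refine and_congr Iff.rfl ⟨fun h => ?_, fun h => mul_neg_of_pos_of_neg (by positivity) h⟩
  by_contra h'
  push Not at h'
  exact absurd h (not_lt.mpr (mul_nonneg (by positivity) h'))

omit hKd hKi in
/-- **Stabilised cylinders are cylinders over stabilised sets** (index bookkeeping). [folklore] -/
theorem stabSet_cylinder (h : 1 + n ≤ 1 + d) (hn : n ≤ d) (T : Set (Fin n → ℝ)) :
    stabSet h {z : Fin (1 + n) → ℝ | (fun j => z (Fin.natAdd 1 j)) ∈ T} =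
      {w : Fin (1 + d) → ℝ | (fun i : Fin d => w (Fin.natAdd 1 i)) ∈ stabSet hn T} := by
  ext w
  simp only [mem_stabSet, mem_setOf_eq]
  have hidx : ∀ j : Fin n, Fin.castLE h (Fin.natAdd 1 j) = Fin.natAdd 1 (Fin.castLE hn j) := fun j =>
    Fin.ext (by simp)
  simp only [hidx]
  refine and_congr Iff.rfl ⟨fun hp i hi => hp (Fin.natAdd 1 i) (by simp; omega), fun hp i hi => ?_⟩
  have hi1 : 1 ≤ (i : ℕ) := by omega
  have : i = Fin.natAdd 1 ⟨(i : ℕ) - 1, by omega⟩ := Fin.ext (by simp; omega)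
  rw [this]
  exact hp _ (by simp; omega)

omit hKd hKi in
/-- Stabilised cylinder densities (index bookkeeping). [folklore] -/
theorem stabFun_cylinder (h : 1 + n ≤ 1 + d) (hn : n ≤ d) (f : (Fin n → ℝ) → ℝ) (c : ℝ)
    (w : Fin (1 + d) → ℝ) :
    stabFun h (fun z : Fin (1 + n) → ℝ => c / (1 + z (Fin.castAdd n 0) ^ 2) *
      f (fun j => z (Fin.natAdd 1 j))) w =
      c / (1 + w (Fin.castAdd d 0) ^ 2) * stabFun hn f (fun i : Fin d => w (Fin.natAdd 1 i)) := by
  simp only [stabFun_apply]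
  have hidx : ∀ j : Fin n, Fin.castLE h (Fin.natAdd 1 j) = Fin.natAdd 1 (Fin.castLE hn j) := fun j =>
    Fin.ext (by simp)
  have h0 : Fin.castLE h (Fin.castAdd n 0) = Fin.castAdd d 0 := Fin.ext (by simp)
  simp only [hidx, h0]

/-- **The stabilised positive part of `K × r` as a catalytic cylinder.** [folklore] -/
theorem stabSet_posSet_prod (r : IntegralRep n) (h : 1 + n ≤ 1 + d) (hn : n ≤ d) :
    stabSet h (posSet (K.prod r)) =
      {w : Fin (1 + d) → ℝ | (fun i : Fin d => w (Fin.natAdd 1 i)) ∈ stabSet hn (posSet r)} := by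
  rw [posSet_prod K hKd hKi, stabSet_cylinder]

/-- **The stabilised negative part of `K × r` as a catalytic cylinder.** [folklore] -/
theorem stabSet_negSet_prod (r : IntegralRep n) (h : 1 + n ≤ 1 + d) (hn : n ≤ d) :
    stabSet h (negSet (K.prod r)) =
      {w : Fin (1 + d) → ℝ | (fun i : Fin d => w (Fin.natAdd 1 i)) ∈ stabSet hn (negSet r)} := by
  rw [negSet_prod K hKd hKi, stabSet_cylinder]

/-- **The stabilised integrand of `K × r` as a catalytic density.** [folklore] -/
theorem stabFun_prod (r : IntegralRep n) (h : 1 + n ≤ 1 + d) (hn : n ≤ d) :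
    stabFun h (K.prod r).integrand = fun w : Fin (1 + d) → ℝ =>
      1 / (1 + w (Fin.castAdd d 0) ^ 2) * stabFun hn r.integrand (fun i : Fin d => w (Fin.natAdd 1 i)) := by
  funext w
  have : (K.prod r).integrand = fun z : Fin (1 + n) → ℝ => 1 / (1 + z (Fin.castAdd n 0) ^ 2) *
      r.integrand (fun j => z (Fin.natAdd 1 j)) := funext (prod_integrand_apply K hKd hKi r)
  rw [this, stabFun_cylinder]

/-- **The negated stabilised integrand of `K × r` as a catalytic density.** [folklore] -/
theorem stabFun_neg_prod (r : IntegralRep n) (h : 1 + n ≤ 1 + d) (hn : n ≤ d) :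
    stabFun h (-(K.prod r).integrand) = fun w : Fin (1 + d) → ℝ =>
      1 / (1 + w (Fin.castAdd d 0) ^ 2) * stabFun hn (-r.integrand) (fun i : Fin d => w (Fin.natAdd 1 i)) := by
  funext w
  have : -(K.prod r).integrand = fun z : Fin (1 + n) → ℝ => 1 / (1 + z (Fin.castAdd n 0) ^ 2) *
      (-r.integrand) (fun j => z (Fin.natAdd 1 j)) := by
    funext z
    simp only [Pi.neg_apply, prod_integrand_apply K hKd hKi r, mul_neg]
  rw [this, stabFun_cylinder]

end Cylinder

/-! ### Headline -/

/-- Registered helper goal of the stub `stub_tameForm`: the positive part of a catalytic product by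
the Cauchy line is the cylinder over the positive part. [folklore] -/
theorem tameForm_aux_posSetProd : ∀ {n : ℕ} (K : IntegralRep 1), K.domain = Set.univ → Set.EqOn K.integrand (fun x => 1 / (1 + x 0 ^ 2)) K.domain → ∀ r : IntegralRep n, posSet (K.prod r) = {z : Fin (1 + n) → ℝ | (fun j => z (Fin.natAdd 1 j)) ∈ posSet r} :=
  fun K hKd hKi r => posSet_prod K hKd hKi r

end Summit.KontsevichZagierPeriods.KontsevichZagierPeriods.BetaCancellationDivisorSlicing

end
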